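import Mathlib
import HarnessLib
import Summits.Ventures.LatticeQCDFlow.Scoring.TwoCodeAgreementUnequalCLT

/-!
# The two-sample agreement test with unequal sample sizes when the printed error bars are
# consistent only IN PROBABILITY (Sen's estimator for the acceptance column, plug-in delta-method
# error bars): `(Sₙ^A − S_{mₙ}^B)/√(V̂ₙ^A + V̂_{mₙ}^B) ⇒ N(0, 1)` still holds

HONEST FRAMING: exact (Metropolis-corrected) sampling algorithms for lattice gauge theory;
figures of merit are autocorrelation/cost numbers at stated couplings and volumes; no
continuum-physics claim.

Venture `LatticeQCDFlow` (cell pub-lqcd), topic `Scoring`; FANOUT row 4 (`s0-u1-b`, rung S0-B: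
"A vs B within `1σ_comb`", every column).  `Scoring/TwoCodeAgreementUnequalCLT` assumed
ALMOST-SURE consistency `n·V̂ₙ → s` of the squared standard errors, which the observable column
has; the acceptance column's error bar (Sen's jackknife-type estimator,
`Scoring/UStatisticVarianceEstimator.senVariance_tendstoInMeasure`) and the delta-method error
bars are consistent only IN PROBABILITY.  This file proves the abstract two-sample theorem under
that weaker hypothesis: **`twoSample_agreement_clt_of_tendstoInMeasure`**.  What changes in the
proof: convergence in probability is transported to the product space `P_A ⊗ P_B`
(**`tendstoInMeasure_comp_fst`**, **`tendstoInMeasure_comp_snd`**, by `Measure.prod_prod` — no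
measurability needed) and along `mₙ → ∞` (`tendstoInMeasure_comp_tendsto`); the pooled-variance
ratio tends to one in probability whatever the weights (**`tendstoInMeasure_weightedRatio_one`**);
and the printed statistic differs from the Slutsky statistic only on the event `{ρₙ ≤ 1/2}`,
whose probability vanishes.  NEW WORK of the cell; no definition; nothing cited as a fact.

## Content

* `tendstoInMeasure_comp_fst`, `tendstoInMeasure_comp_snd`, `tendstoInMeasure_comp_tendsto`;
* **`tendstoInMeasure_weightedRatio_one`**;
* **`twoSample_agreement_clt_of_tendstoInMeasure`** — the abstract two-sample test, error bars
  consistent in probability, any `mₙ → ∞`.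

NOT CLAIMED: the concrete acceptance / ESS / free-energy columns (each follows by supplying its
one-code CLT and error-bar consistency from the `Scoring/` packet); degenerate variances;
dependent codes.
-/

noncomputable section

namespace Summit.Ventures.LatticeQCDFlow.Scoring.CardConsistency

open MeasureTheory ProbabilityTheory Finset Real Filter
open scoped Topology Function ENNReal

/-! ## §1 Convergence in probability on a product space and along a subsequence -/

section Transport

variable {ΩA : Type*} [MeasurableSpace ΩA] {PA : Measure ΩA} [IsProbabilityMeasure PA]
variable {ΩB : Type*} [MeasurableSpace ΩB] {PB : Measure ΩB} [IsProbabilityMeasure PB]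
variable {E : Type*} [EDist E]

omit [IsProbabilityMeasure PA] in
/-- **A statistic of code `A` keeps its in-probability limit when read on `P_A ⊗ P_B`.** [ours]
(`(P_A ⊗ P_B)(S × Ω_B) = P_A(S)`, for any set `S`) -/
theorem tendstoInMeasure_comp_fst {f : ℕ → ΩA → E} {g : ΩA → E}
    (h : TendstoInMeasure PA f atTop g) :
    TendstoInMeasure (PA.prod PB) (fun n (ω : ΩA × ΩB) => f n ω.1) atTop fun ω => g ω.1 := by
  intro ε hε
  have e : ∀ n, (PA.prod PB) {ω : ΩA × ΩB | ε ≤ edist (f n ω.1) (g ω.1)}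
      = PA {x | ε ≤ edist (f n x) (g x)} := by
    intro n
    rw [show {ω : ΩA × ΩB | ε ≤ edist (f n ω.1) (g ω.1)}
        = {x | ε ≤ edist (f n x) (g x)} ×ˢ (Set.univ : Set ΩB) by
      ext ω; simp, Measure.prod_prod, measure_univ, mul_one]
  simp_rw [e]
  exact h ε hε

/-- **A statistic of code `B` keeps its in-probability limit when read on `P_A ⊗ P_B`.** [ours] -/
theorem tendstoInMeasure_comp_snd {f : ℕ → ΩB → E} {g : ΩB → E}
    (h : TendstoInMeasure PB f atTop g) :
    TendstoInMeasure (PA.prod PB) (fun n (ω : ΩA × ΩB) => f n ω.2) atTop fun ω => g ω.2 := by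
  intro ε hε
  have e : ∀ n, (PA.prod PB) {ω : ΩA × ΩB | ε ≤ edist (f n ω.2) (g ω.2)}
      = PB {x | ε ≤ edist (f n x) (g x)} := by
    intro n
    rw [show {ω : ΩA × ΩB | ε ≤ edist (f n ω.2) (g ω.2)}
        = (Set.univ : Set ΩA) ×ˢ {x | ε ≤ edist (f n x) (g x)} by
      ext ω; simp, Measure.prod_prod, measure_univ, one_mul]
  simp_rw [e]
  exact h ε hε

omit [IsProbabilityMeasure PA] in
/-- **Convergence in probability passes to `n ↦ f_{mₙ}` for `mₙ → ∞`.** [ours] -/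
theorem tendstoInMeasure_comp_tendsto {f : ℕ → ΩA → E} {g : ΩA → E}
    (h : TendstoInMeasure PA f atTop g) {m : ℕ → ℕ} (hm : Tendsto m atTop atTop) :
    TendstoInMeasure PA (fun n => f (m n)) atTop g :=
  fun ε hε => (h ε hε).comp hm

end Transport

/-! ## §2 The pooled-variance ratio, in probability -/

section Ratio

variable {Ω : Type*} [MeasurableSpace Ω] {P : Measure Ω}

/-- **The pooled-variance ratio tends to one in probability whatever the weights**: real random
sequences `xₙ → s_A > 0`, `yₙ → s_B > 0` in probability and deterministic weights, eventually
`pₙ, qₙ ≥ 0` with `pₙ + qₙ > 0` ⇒ `(xₙpₙ + yₙqₙ)/(s_Apₙ + s_Bqₙ) → 1` in probability. [ours] -/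
theorem tendstoInMeasure_weightedRatio_one {x y : ℕ → Ω → ℝ} {p q : ℕ → ℝ} {sA sB : ℝ}
    (hsA : 0 < sA) (hsB : 0 < sB) (hx : TendstoInMeasure P x atTop fun _ => sA)
    (hy : TendstoInMeasure P y atTop fun _ => sB)
    (hpq : ∀ᶠ n in atTop, 0 ≤ p n ∧ 0 ≤ q n ∧ 0 < p n + q n) :
    TendstoInMeasure P (fun n ω => (x n ω * p n + y n ω * q n) / (sA * p n + sB * q n)) atTop
      fun _ => (1 : ℝ) := by
  rw [tendstoInMeasure_iff_norm] at hx hy ⊢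
  intro ε hε
  have hxε := hx (ε / 2 * sA) (by positivity)
  have hyε := hy (ε / 2 * sB) (by positivity)
  have hsum := hxε.add hyε
  rw [add_zero] at hsum
  refine tendsto_of_tendsto_of_tendsto_of_le_of_le' tendsto_const_nhds hsum
    (Eventually.of_forall fun n => zero_le) ?_
  filter_upwards [hpq] with n hn
  refine (measure_mono fun ω hω => ?_).trans (measure_union_le _ _)
  simp only [Set.mem_setOf_eq, Set.mem_union] at hω ⊢
  by_contra hboth
  push Not at hboth
  have hb := abs_weightedRatio_sub_one_le (x := x n ω) (y := y n ω) hsA hsB hn.1 hn.2.1 hn.2.2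
  rw [Real.norm_eq_abs] at hω
  rw [Real.norm_eq_abs, Real.norm_eq_abs] at hboth
  have h1 : |x n ω - sA| / sA < ε / 2 := by
    rw [div_lt_iff₀ hsA]
    exact hboth.1
  have h2 : |y n ω - sB| / sB < ε / 2 := by
    rw [div_lt_iff₀ hsB]
    exact hboth.2
  linarith

end Ratio

/-! ## §3 The abstract two-sample test, error bars consistent in probability -/

section Abstract

variable {ΩA : Type*} [MeasurableSpace ΩA] {PA : Measure ΩA} [IsProbabilityMeasure PA]
variable {ΩB : Type*} [MeasurableSpace ΩB] {PB : Measure ΩB} [IsProbabilityMeasure PB]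
variable {Ω' : Type*} [MeasurableSpace Ω'] {P' : Measure Ω'} [IsProbabilityMeasure P']

/-- **THE TWO-SAMPLE AGREEMENT TEST, ERROR BARS CONSISTENT IN PROBABILITY.**  As
`twoSample_agreement_clt` (two independent codes, one-code central limit theorems
`√n(Sₙ^X − a) ⇒ N(0, s_X)`, `s_X > 0`, code `B` read along any `mₙ → ∞`), but the squared
standard errors need only satisfy `n·V̂ₙ^X → s_X` IN PROBABILITY.  Then on `P_A ⊗ P_B`:
`(Sₙ^A − S_{mₙ}^B)/√(V̂ₙ^A + V̂_{mₙ}^B) ⇒ Z ∼ N(0, 1)`. [ours] -/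
theorem twoSample_agreement_clt_of_tendstoInMeasure {SA VA : ℕ → ΩA → ℝ} {SB VB : ℕ → ΩB → ℝ}
    {a sA sB : ℝ} {ZA ZB Z : Ω' → ℝ} (hsA : 0 < sA) (hsB : 0 < sB)
    (hSAm : ∀ n, Measurable (SA n)) (hVAm : ∀ n, Measurable (VA n))
    (hSBm : ∀ n, Measurable (SB n)) (hVBm : ∀ n, Measurable (VB n))
    (hcltA : TendstoInDistribution (fun (n : ℕ) ω => Real.sqrt n * (SA n ω - a)) atTop ZA
      (fun _ => PA) P') (hZA : HasLaw ZA (gaussianReal 0 sA.toNNReal) P')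
    (hcltB : TendstoInDistribution (fun (n : ℕ) ω => Real.sqrt n * (SB n ω - a)) atTop ZB
      (fun _ => PB) P') (hZB : HasLaw ZB (gaussianReal 0 sB.toNNReal) P')
    (hVA : TendstoInMeasure PA (fun (n : ℕ) ω => (n : ℝ) * VA n ω) atTop fun _ => sA)
    (hVB : TendstoInMeasure PB (fun (n : ℕ) ω => (n : ℝ) * VB n ω) atTop fun _ => sB)
    {m : ℕ → ℕ} (hm : Tendsto m atTop atTop) (hZ : HasLaw Z (gaussianReal 0 1) P') :
    TendstoInDistribution (fun (n : ℕ) (ω : ΩA × ΩB) =>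
        (SA n ω.1 - SB (m n) ω.2) / Real.sqrt (VA n ω.1 + VB (m n) ω.2))
      atTop Z (fun _ => PA.prod PB) P' := by
  -- Step 1: the two centred, scaled columns on the product space, code `B` along `mₙ`
  have hU : TendstoInDistribution (fun (n : ℕ) (ω : ΩA × ΩB) => Real.sqrt n * (SA n ω.1 - a))
      atTop ZA (fun _ => PA.prod PB) P' :=
    tendstoInDistribution_comp_fst hcltA
  have hW : TendstoInDistribution
      (fun (n : ℕ) (ω : ΩA × ΩB) => Real.sqrt (m n : ℕ) * (SB (m n) ω.2 - a))
      atTop ZB (fun _ => PA.prod PB) P' :=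
    tendstoInDistribution_comp_snd (tendstoInDistribution_comp_tendsto hcltB hm)
  have hUW : ∀ n : ℕ, IndepFun (fun ω : ΩA × ΩB => Real.sqrt n * (SA n ω.1 - a))
      (fun ω : ΩA × ΩB => Real.sqrt (m n : ℕ) * (SB (m n) ω.2 - a)) (PA.prod PB) := fun n =>
    indepFun_prod₀ (((hSAm n).sub_const a).const_mul _).aemeasurable
      (((hSBm (m n)).sub_const a).const_mul _).aemeasurable
  -- Step 2: the coefficients
  have hαβ : ∀ᶠ n : ℕ in atTop,
      sA * (Real.sqrt (m n : ℕ) / Real.sqrt (sA * (m n : ℕ) + sB * n)) ^ 2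
        + sB * (Real.sqrt n / Real.sqrt (sA * (m n : ℕ) + sB * n)) ^ 2 = 1 := by
    filter_upwards [eventually_ge_atTop 1] with n hn
    have hn0 : (0 : ℝ) < n := by exact_mod_cast hn
    have hD : 0 < sA * (m n : ℕ) + sB * n :=
      add_pos_of_nonneg_of_pos (mul_nonneg hsA.le (Nat.cast_nonneg _)) (mul_pos hsB hn0)
    rw [div_pow, div_pow, Real.sq_sqrt (Nat.cast_nonneg _), Real.sq_sqrt hn0.le,
      Real.sq_sqrt hD.le]
    field_simp
  have hL := tendstoInDistribution_gaussianCombination hsA hsB hU hZA hW hZB hUW hαβ hZ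
  -- Step 3: the pooled-variance ratio `ρₙ → 1` in probability on the product space
  have hA' : TendstoInMeasure (PA.prod PB) (fun (n : ℕ) (ω : ΩA × ΩB) => (n : ℝ) * VA n ω.1)
      atTop fun _ => sA :=
    tendstoInMeasure_comp_fst hVA
  have hB' : TendstoInMeasure (PA.prod PB)
      (fun (n : ℕ) (ω : ΩA × ΩB) => ((m n : ℕ) : ℝ) * VB (m n) ω.2) atTop fun _ => sB :=
    tendstoInMeasure_comp_snd (tendstoInMeasure_comp_tendsto hVB hm)
  have hpq : ∀ᶠ n : ℕ in atTop, 0 ≤ (n : ℝ)⁻¹ ∧ 0 ≤ ((m n : ℕ) : ℝ)⁻¹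
      ∧ 0 < (n : ℝ)⁻¹ + ((m n : ℕ) : ℝ)⁻¹ := by
    filter_upwards [eventually_ge_atTop 1] with n hn
    have hn0 : (0 : ℝ) < n := by exact_mod_cast hn
    exact ⟨(inv_pos.2 hn0).le, inv_nonneg.2 (Nat.cast_nonneg _),
      add_pos_of_pos_of_nonneg (inv_pos.2 hn0) (inv_nonneg.2 (Nat.cast_nonneg _))⟩
  have hρ : TendstoInMeasure (PA.prod PB) (fun (n : ℕ) (ω : ΩA × ΩB) =>
      ((n : ℝ) * VA n ω.1 * (n : ℝ)⁻¹ + ((m n : ℕ) : ℝ) * VB (m n) ω.2 * ((m n : ℕ) : ℝ)⁻¹)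
        / (sA * (n : ℝ)⁻¹ + sB * ((m n : ℕ) : ℝ)⁻¹)) atTop fun _ => (1 : ℝ) :=
    tendstoInMeasure_weightedRatio_one hsA hsB hA' hB' hpq
  have hρm : ∀ n : ℕ, Measurable fun ω : ΩA × ΩB =>
      ((n : ℝ) * VA n ω.1 * (n : ℝ)⁻¹ + ((m n : ℕ) : ℝ) * VB (m n) ω.2 * ((m n : ℕ) : ℝ)⁻¹)
        / (sA * (n : ℝ)⁻¹ + sB * ((m n : ℕ) : ℝ)⁻¹) := fun n =>
    (((((hVAm n).comp measurable_fst).const_mul _).mul_const _).add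
      ((((hVBm (m n)).comp measurable_snd).const_mul _).mul_const _)).div_const _
  -- Step 4: Slutsky with `g(x, r) = x/√(max(r, 1/2))`
  have hgc : Continuous fun z : ℝ × ℝ => z.1 / Real.sqrt (max z.2 (1 / 2)) :=
    continuous_fst.div (continuous_snd.max continuous_const).sqrt fun z =>
      (Real.sqrt_pos.2 (lt_max_of_lt_right one_half_pos)).ne'
  have hsl := hL.continuous_comp_prodMk_of_tendstoInMeasure_const hgc hρ
    (fun n => (hρm n).aemeasurable)
  have elim : (fun ω' => Z ω' / Real.sqrt (max (1 : ℝ) (1 / 2))) = Z := by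
    funext ω'
    rw [max_eq_left (by norm_num), Real.sqrt_one, div_one]
  rw [elim] at hsl
  -- Step 5: the printed statistic differs from the Slutsky statistic only on `{ρₙ ≤ 1/2}`
  have hTm : ∀ n : ℕ, Measurable fun ω : ΩA × ΩB =>
      (SA n ω.1 - SB (m n) ω.2) / Real.sqrt (VA n ω.1 + VB (m n) ω.2) := fun n =>
    (((hSAm n).comp measurable_fst).sub ((hSBm (m n)).comp measurable_snd)).div
      (((hVAm n).comp measurable_fst).add ((hVBm (m n)).comp measurable_snd)).sqrt
  refine tendstoInDistribution_of_tendstoInMeasure_sub _ _ hsl ?_ (fun n => (hTm n).aemeasurable)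
  rw [tendstoInMeasure_iff_norm]
  intro ε hε
  have hρ' := (tendstoInMeasure_iff_norm.1 hρ) (1 / 2) one_half_pos
  refine tendsto_of_tendsto_of_tendsto_of_le_of_le' tendsto_const_nhds hρ'
    (Eventually.of_forall fun n => zero_le) ?_
  filter_upwards [eventually_ge_atTop 1, hm.eventually (eventually_ge_atTop 1)] with n hn1 hm1
  refine measure_mono fun ω hω => ?_
  simp only [Set.mem_setOf_eq] at hω ⊢
  by_contra hlt
  push Not at hlt
  rw [Real.norm_eq_abs, abs_sub_lt_iff] at hlt
  have hρge : (1 : ℝ) / 2 ≤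
      ((n : ℝ) * VA n ω.1 * (n : ℝ)⁻¹ + ((m n : ℕ) : ℝ) * VB (m n) ω.2 * ((m n : ℕ) : ℝ)⁻¹)
        / (sA * (n : ℝ)⁻¹ + sB * ((m n : ℕ) : ℝ)⁻¹) := by linarith [hlt.1, hlt.2]
  have hzero : (SA n ω.1 - SB (m n) ω.2) / Real.sqrt (VA n ω.1 + VB (m n) ω.2)
      - (Real.sqrt (m n : ℕ) / Real.sqrt (sA * (m n : ℕ) + sB * n) * (Real.sqrt n * (SA n ω.1 - a))
          - Real.sqrt n / Real.sqrt (sA * (m n : ℕ) + sB * n)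
            * (Real.sqrt (m n : ℕ) * (SB (m n) ω.2 - a)))
        / Real.sqrt (max (((n : ℝ) * VA n ω.1 * (n : ℝ)⁻¹
            + ((m n : ℕ) : ℝ) * VB (m n) ω.2 * ((m n : ℕ) : ℝ)⁻¹)
            / (sA * (n : ℝ)⁻¹ + sB * ((m n : ℕ) : ℝ)⁻¹)) (1 / 2)) = 0 := by
    rw [max_eq_left hρge, twoSample_studentise_eq hn1 hm1 hsA hsB (SA n ω.1) (SB (m n) ω.2) a
      (VA n ω.1) (VB (m n) ω.2), sub_self]
  rw [Pi.sub_apply, Pi.sub_apply, Pi.zero_apply, sub_zero, hzero, norm_zero] at hω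
  exact absurd hω (not_le.2 hε)

end Abstract

end Summit.Ventures.LatticeQCDFlow.Scoring.CardConsistency

end
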